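import Mathlib
import HarnessLib
import Summits.CriticalPhenomena.PercolationContinuityZ3.Theorems.PercNearOneGluingNoHeavyLowerTailSahiGridPatternZProfile

/-!
# `NoHeavyLowerTail` (crux stmt-CriticalPhenomena-4575), antithetic vdBHK programme: the CUBE CHARGE INEQUALITY (from Kleitman's lemma)

Support file (seat `prim-ineq-gen-7` gen 24; `--supports stmt-CriticalPhenomena-4575`).  Nothing is asserted about the crux; no `sorry`,
no definitions.  Memo: run/shared/lean/prim/prim-ineq-gen-7/FINDING-SUNS-g24.md §1–§3.

CONTEXT.  THEOREM E of the memo (RAA, hence ULEX for every source, for EVERY sun graph `C_n` + leaves at cycle vertices, any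
multiplicities, any root) is proved by an induction over blocks of `r` leaves at one cycle vertex.  A block is an `r`-fold twisted double
`X^{(r)}(P,D) = P × B_r` of the previous poset (`B_r` = the Boolean lattice with antipode `ι`); its 'Z-layer' is charged to the `2^r` worlds
by the BLOCK-TWIST LEMMA (memo §1), and the per-pair bookkeeping of that lemma is EXACTLY the following inequality on the cube
(memo §2, 'CUBE-INEQ'):

THEOREM (`cube_charge`).  For up-sets `A⁺, B⁺` and down-sets `A⁻, B⁻` of the Boolean lattice of subsets of a finite type, with `Sᶜˢ` the
family of complements,
  `#(A⁺ ∩ B⁻) + #(A⁻ ∩ B⁺) ≤ #(A⁺ ∩ B⁺) + #(A⁻ ∩ B⁻) + #((A⁺ᶜˢ ∩ B⁻) ∪ (A⁻ ∩ B⁺ᶜˢ))`.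
Proof: `C₁ ∩ C₂ ⊆ (A⁺ ∩ B⁺)ᶜˢ` for `C₁ = A⁺ᶜˢ ∩ B⁻`, `C₂ = A⁻ ∩ B⁺ᶜˢ`, and KLEITMAN twice: `2^n #(A⁺ ∩ B⁻) ≤ #A⁺ · #B⁻ = #A⁺ᶜˢ · #B⁻ ≤ 2^n #C₁`
(up/down anticorrelate, down/down correlate), likewise `#(A⁻ ∩ B⁺) ≤ #C₂`.
* `AntitheticCube.isUpperSet_compls` — complements of a lower family form an upper family (the upper→lower direction is
  `SahiGridPattern.isLowerSet_compls`, imported);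
* `AntitheticCube.card_inter_le_card_compls_inter`, `card_inter_le_card_inter_compls` — the two Kleitman consequences;
* `AntitheticCube.cube_charge` — the theorem;
* `AntitheticCube.port_charge` — the PORT FORM used verbatim in the block-twist lemma: for up-sets `a, a', b, b'`,
  `#(a ∩ b'ᶜˢ) + #(a' ∩ bᶜˢ) ≤ #(a ∩ b) + #(a' ∩ b') + #(((aᶜˢ ∩ b'ᶜˢ) \ (a' ∪ b)) ∪ ((a'ᶜˢ ∩ bᶜˢ) \ (a ∪ b')))`
  (`cube_charge` at `A⁺ = a \ a'ᶜˢ`, `A⁻ = a'ᶜˢ \ a`, `B± ` likewise, plus an indicator identity).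
-/

namespace Summit.CriticalPhenomena.PercolationContinuityZ3.Theorems

open Finset
open scoped FinsetFamily

namespace AntitheticCube

variable {α : Type*} [DecidableEq α] [Fintype α]

/-- The complements of a lower family of finsets form an upper family. [this work] -/
theorem isUpperSet_compls {𝒜 : Finset (Finset α)} (h : IsLowerSet (𝒜 : Set (Finset α))) :
    IsUpperSet ((𝒜ᶜˢ : Finset (Finset α)) : Set (Finset α)) := by
  intro s t hst hs
  rw [Finset.mem_coe, Finset.mem_compls] at hs ⊢
  exact h (compl_le_compl hst) hs

/-- `#(Sᶜˢ ∩ T) = #(S ∩ Tᶜˢ)` (apply the complement map to one of the two sets). [this work] -/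
theorem card_compls_inter (S T : Finset (Finset α)) : (Sᶜˢ ∩ T).card = (S ∩ Tᶜˢ).card := by
  rw [← Finset.card_compls (Sᶜˢ ∩ T), Finset.compls_inter, Finset.compls_compls]

/-- KLEITMAN, first consequence: for an upper family `A` and a lower family `B`, `#(A ∩ B) ≤ #(Aᶜˢ ∩ B)`
(`2^n #(A ∩ B) ≤ #A #B = #Aᶜˢ #B ≤ 2^n #(Aᶜˢ ∩ B)`). [this work] -/
theorem card_inter_le_card_compls_inter (A B : Finset (Finset α))
    (hA : IsUpperSet (A : Set (Finset α))) (hB : IsLowerSet (B : Set (Finset α))) :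
    (A ∩ B).card ≤ (Aᶜˢ ∩ B).card := by
  have h1 := hA.card_inter_le_finset hB
  have h2 := (SahiGridPattern.isLowerSet_compls hA).le_card_inter_finset hB
  rw [Finset.card_compls] at h2
  exact Nat.le_of_mul_le_mul_left (h1.trans h2) (by positivity)

/-- KLEITMAN, second consequence: for a lower family `A` and an upper family `B`, `#(A ∩ B) ≤ #(A ∩ Bᶜˢ)`. [this work] -/
theorem card_inter_le_card_inter_compls (A B : Finset (Finset α))
    (hA : IsLowerSet (A : Set (Finset α))) (hB : IsUpperSet (B : Set (Finset α))) :
    (A ∩ B).card ≤ (A ∩ Bᶜˢ).card := by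
  have h1 := hA.card_inter_le_finset hB
  have h2 := hA.le_card_inter_finset (SahiGridPattern.isLowerSet_compls hB)
  rw [Finset.card_compls] at h2
  exact Nat.le_of_mul_le_mul_left (h1.trans h2) (by positivity)

/-- **CUBE CHARGE INEQUALITY.**  For upper families `A⁺, B⁺` and lower families `A⁻, B⁻` of subsets of a finite type:
`#(A⁺ ∩ B⁻) + #(A⁻ ∩ B⁺) ≤ #(A⁺ ∩ B⁺) + #(A⁻ ∩ B⁻) + #((A⁺ᶜˢ ∩ B⁻) ∪ (A⁻ ∩ B⁺ᶜˢ))`.  [this work; memo §2] -/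
theorem cube_charge (Ap Am Bp Bm : Finset (Finset α))
    (hAp : IsUpperSet (Ap : Set (Finset α))) (hBp : IsUpperSet (Bp : Set (Finset α)))
    (hAm : IsLowerSet (Am : Set (Finset α))) (hBm : IsLowerSet (Bm : Set (Finset α))) :
    (Ap ∩ Bm).card + (Am ∩ Bp).card ≤ (Ap ∩ Bp).card + (Am ∩ Bm).card + ((Apᶜˢ ∩ Bm) ∪ (Am ∩ Bpᶜˢ)).card := by
  have h1 : (Ap ∩ Bm).card ≤ (Apᶜˢ ∩ Bm).card := card_inter_le_card_compls_inter Ap Bm hAp hBm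
  have h2 : (Am ∩ Bp).card ≤ (Am ∩ Bpᶜˢ).card := card_inter_le_card_inter_compls Am Bp hAm hBp
  have h3 : ((Apᶜˢ ∩ Bm) ∩ (Am ∩ Bpᶜˢ)).card ≤ (Ap ∩ Bp).card := by
    calc ((Apᶜˢ ∩ Bm) ∩ (Am ∩ Bpᶜˢ)).card ≤ (Apᶜˢ ∩ Bpᶜˢ).card := by
          refine Finset.card_le_card ?_
          intro x hx
          simp only [Finset.mem_inter] at hx ⊢
          exact ⟨hx.1.1, hx.2.2⟩
      _ = (Ap ∩ Bp).card := by rw [← Finset.compls_inter, Finset.card_compls]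
  have h4 := Finset.card_union_add_card_inter (Apᶜˢ ∩ Bm) (Am ∩ Bpᶜˢ)
  omega

/-- Indicator of a finset (`ℤ`-valued). -/
private theorem card_inter_eq_sum (S T : Finset (Finset α)) :
    ((S ∩ T).card : ℤ) = ∑ s : Finset α, (if s ∈ S then (1:ℤ) else 0) * (if s ∈ T then (1:ℤ) else 0) := by
  have : ∀ s : Finset α, (if s ∈ S then (1:ℤ) else 0) * (if s ∈ T then (1:ℤ) else 0) = if s ∈ S ∩ T then (1:ℤ) else 0 := by
    intro s
    by_cases h1 : s ∈ S <;> by_cases h2 : s ∈ T <;> simp [h1, h2, Finset.mem_inter]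
  simp_rw [this]
  rw [Finset.sum_boole, Finset.filter_mem_eq_inter, Finset.univ_inter]

/-- **PORT FORM of the cube charge inequality** (the per-pair inequality (F5) of the block-twist lemma, memo §1–§2).  For upper
families `a, a', b, b'` (the port sets of an antipodal pair `{z, ι z}` in `A` and `B`):
`#(a ∩ b'ᶜˢ) + #(a' ∩ bᶜˢ) ≤ #(a ∩ b) + #(a' ∩ b') + #(C_V ∪ C_W)` with `C_V = (aᶜˢ ∩ b'ᶜˢ) \ (a' ∪ b)`,
`C_W = (a'ᶜˢ ∩ bᶜˢ) \ (a ∪ b')` (the sets of worlds in which the V- resp. W-embedding certificate holds). [this work] -/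
theorem port_charge (a a' b b' : Finset (Finset α))
    (ha : IsUpperSet (a : Set (Finset α))) (ha' : IsUpperSet (a' : Set (Finset α)))
    (hb : IsUpperSet (b : Set (Finset α))) (hb' : IsUpperSet (b' : Set (Finset α))) :
    (a ∩ b'ᶜˢ).card + (a' ∩ bᶜˢ).card
      ≤ (a ∩ b).card + (a' ∩ b').card + ((((aᶜˢ ∩ b'ᶜˢ) \ (a' ∪ b)) ∪ ((a'ᶜˢ ∩ bᶜˢ) \ (a ∪ b')))).card := by
  -- the four signed families
  set Ap := a \ a'ᶜˢ with hAp_def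
  set Am := a'ᶜˢ \ a with hAm_def
  set Bp := b \ b'ᶜˢ with hBp_def
  set Bm := b'ᶜˢ \ b with hBm_def
  have hAp : IsUpperSet (Ap : Set (Finset α)) := by
    rw [hAp_def, Finset.coe_sdiff, Set.sdiff_eq]; exact ha.inter (SahiGridPattern.isLowerSet_compls ha').compl
  have hBp : IsUpperSet (Bp : Set (Finset α)) := by
    rw [hBp_def, Finset.coe_sdiff, Set.sdiff_eq]; exact hb.inter (SahiGridPattern.isLowerSet_compls hb').compl
  have hAm : IsLowerSet (Am : Set (Finset α)) := by
    rw [hAm_def, Finset.coe_sdiff, Set.sdiff_eq]; exact (SahiGridPattern.isLowerSet_compls ha').inter ha.compl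
  have hBm : IsLowerSet (Bm : Set (Finset α)) := by
    rw [hBm_def, Finset.coe_sdiff, Set.sdiff_eq]; exact (SahiGridPattern.isLowerSet_compls hb').inter hb.compl
  have hcube := cube_charge Ap Am Bp Bm hAp hBp hAm hBm
  -- the certificate sets coincide
  have hCV : Apᶜˢ ∩ Bm = (aᶜˢ ∩ b'ᶜˢ) \ (a' ∪ b) := by
    ext s
    simp only [hAp_def, hBm_def, Finset.mem_inter, Finset.mem_compls, Finset.mem_sdiff, Finset.mem_union, compl_compl]
    tauto
  have hCW : Am ∩ Bpᶜˢ = (a'ᶜˢ ∩ bᶜˢ) \ (a ∪ b') := by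
    ext s
    simp only [hAm_def, hBp_def, Finset.mem_inter, Finset.mem_compls, Finset.mem_sdiff, Finset.mem_union, compl_compl]
    tauto
  rw [hCV, hCW] at hcube
  -- the signed count identity: #(A⁺∩B⁺) + #(A⁻∩B⁻) − #(A⁺∩B⁻) − #(A⁻∩B⁺) = #(a∩b) + #(a'∩b') − #(a∩b'ᶜˢ) − #(a'∩bᶜˢ)
  have hpt : ∀ s : Finset α,
      ((if s ∈ Ap then (1:ℤ) else 0) - (if s ∈ Am then (1:ℤ) else 0)) = ((if s ∈ a then (1:ℤ) else 0) - (if s ∈ a'ᶜˢ then (1:ℤ) else 0)) := by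
    intro s
    by_cases h1 : s ∈ a <;> by_cases h2 : s ∈ a'ᶜˢ <;> simp [hAp_def, hAm_def, h1, h2]
  have hptB : ∀ s : Finset α,
      ((if s ∈ Bp then (1:ℤ) else 0) - (if s ∈ Bm then (1:ℤ) else 0)) = ((if s ∈ b then (1:ℤ) else 0) - (if s ∈ b'ᶜˢ then (1:ℤ) else 0)) := by
    intro s
    by_cases h1 : s ∈ b <;> by_cases h2 : s ∈ b'ᶜˢ <;> simp [hBp_def, hBm_def, h1, h2]
  have hsum : ∑ s : Finset α, ((if s ∈ Ap then (1:ℤ) else 0) - (if s ∈ Am then (1:ℤ) else 0)) *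
        ((if s ∈ Bp then (1:ℤ) else 0) - (if s ∈ Bm then (1:ℤ) else 0))
      = ∑ s : Finset α, ((if s ∈ a then (1:ℤ) else 0) - (if s ∈ a'ᶜˢ then (1:ℤ) else 0)) *
        ((if s ∈ b then (1:ℤ) else 0) - (if s ∈ b'ᶜˢ then (1:ℤ) else 0)) := by
    refine Finset.sum_congr rfl (fun s _ => ?_)
    rw [hpt s, hptB s]
  have hL : ∑ s : Finset α, ((if s ∈ Ap then (1:ℤ) else 0) - (if s ∈ Am then (1:ℤ) else 0)) *
        ((if s ∈ Bp then (1:ℤ) else 0) - (if s ∈ Bm then (1:ℤ) else 0))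
      = ((Ap ∩ Bp).card : ℤ) - (Ap ∩ Bm).card - (Am ∩ Bp).card + (Am ∩ Bm).card := by
    rw [card_inter_eq_sum, card_inter_eq_sum, card_inter_eq_sum, card_inter_eq_sum, ← Finset.sum_sub_distrib,
      ← Finset.sum_sub_distrib, ← Finset.sum_add_distrib]
    exact Finset.sum_congr rfl (fun s _ => by ring)
  have hR : ∑ s : Finset α, ((if s ∈ a then (1:ℤ) else 0) - (if s ∈ a'ᶜˢ then (1:ℤ) else 0)) *
        ((if s ∈ b then (1:ℤ) else 0) - (if s ∈ b'ᶜˢ then (1:ℤ) else 0))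
      = ((a ∩ b).card : ℤ) - (a ∩ b'ᶜˢ).card - (a'ᶜˢ ∩ b).card + (a'ᶜˢ ∩ b'ᶜˢ).card := by
    rw [card_inter_eq_sum, card_inter_eq_sum, card_inter_eq_sum, card_inter_eq_sum, ← Finset.sum_sub_distrib,
      ← Finset.sum_sub_distrib, ← Finset.sum_add_distrib]
    exact Finset.sum_congr rfl (fun s _ => by ring)
  have hc1 : (a'ᶜˢ ∩ b).card = (a' ∩ bᶜˢ).card := card_compls_inter a' b
  have hc2 : (a'ᶜˢ ∩ b'ᶜˢ).card = (a' ∩ b').card := by rw [← Finset.compls_inter, Finset.card_compls]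
  have hid : ((Ap ∩ Bp).card : ℤ) - (Ap ∩ Bm).card - (Am ∩ Bp).card + (Am ∩ Bm).card
      = ((a ∩ b).card : ℤ) - (a ∩ b'ᶜˢ).card - (a' ∩ bᶜˢ).card + (a' ∩ b').card := by
    rw [← hL, hsum, hR, hc1, hc2]
  omega


/-! ### The block-insertion lemma (appended, gen 24): 2^r worlds and a cube of ports

One antipodal pair `{z, ιz}` of the Z-layer of an `r`-fold twisted double (memo FINDING-SUNS-g24.md §1, LEMMA B steps (F2), (F4)⇒(★), (F5);
PROOF-THME-g24.md).  Ambient preorder `P` with a map `ι`; the `2^r` WORLDS are finite sets `S w`, `w : Finset (Fin r)` (a point of the cube;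
complement = antipode); the PORTS are two monotone maps `zf, zf' : Finset (Fin r) → P` (`zf ρ = (z,ρ)`, `zf' ρ = (ιz,ρ)`) with `ι (zf ρ) = zf' ρᶜ`,
`ι (zf' ρ) = zf ρᶜ`.  With the AK summand `φ u := 1_A(u)(1_B(u) − 1_B(ι u))`: if every world has `Σ_{S w} φ ≥ 0` and the EMBEDDING CERTIFICATES
  V(w): `zf wᶜ ∈ A → zf' w ∉ A → zf' wᶜ ∈ B → zf w ∉ B → Σ_{S w} φ ≥ 1`,   W(w): `zf' wᶜ ∈ A → zf w ∉ A → zf wᶜ ∈ B → zf' w ∉ B → Σ_{S w} φ ≥ 1`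
hold, then `Σ_w Σ_{S w} φ + Σ_ρ φ(zf ρ) + Σ_ρ φ(zf' ρ) ≥ 0` for all up-sets `A, B`.  (Summing over the pairs of the antichain `Z` gives LEMMA B; in the
application the certificates come from AK of `P₀ ∖ holes ∖ (uncharged pairs)` by the embedding (F4).  For r = 1 and two worlds this is
`AntitheticPort.pair_insertion`.)  Proof: the port sums are `#(a∩b) − #(a∩b'ᶜˢ) + #(a'∩b') − #(a'∩bᶜˢ)` for the up-sets `a = {ρ : zf ρ ∈ A}`, … of the
cube, the certified worlds are `C_V ∪ C_W` of `port_charge`, and `Σ_w Σ_{S w} φ ≥ #(C_V ∪ C_W)`. -/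

section Block

variable {P : Type*} [Preorder P] [DecidableEq P] {r : ℕ}

/-- **Block-insertion lemma (LEMMA B of the memo, one antipodal pair, general `r`).** [this work; memo §1] -/
theorem block_insertion (ι : P → P) (S : Finset (Fin r) → Finset P) (zf zf' : Finset (Fin r) → P)
    (hzf : Monotone zf) (hzf' : Monotone zf')
    (hι : ∀ ρ, ι (zf ρ) = zf' ρᶜ) (hι' : ∀ ρ, ι (zf' ρ) = zf ρᶜ)
    (A B : Finset P) (hA : ∀ u v, u ≤ v → u ∈ A → v ∈ A) (hB : ∀ u v, u ≤ v → u ∈ B → v ∈ B)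
    (h0 : ∀ w, 0 ≤ ∑ u ∈ S w, ((if u ∈ A then (1:ℤ) else 0) * ((if u ∈ B then (1:ℤ) else 0) - (if ι u ∈ B then (1:ℤ) else 0))))
    (EV : ∀ w, zf wᶜ ∈ A → zf' w ∉ A → zf' wᶜ ∈ B → zf w ∉ B →
      1 ≤ ∑ u ∈ S w, ((if u ∈ A then (1:ℤ) else 0) * ((if u ∈ B then (1:ℤ) else 0) - (if ι u ∈ B then (1:ℤ) else 0))))
    (EW : ∀ w, zf' wᶜ ∈ A → zf w ∉ A → zf wᶜ ∈ B → zf' w ∉ B →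
      1 ≤ ∑ u ∈ S w, ((if u ∈ A then (1:ℤ) else 0) * ((if u ∈ B then (1:ℤ) else 0) - (if ι u ∈ B then (1:ℤ) else 0)))) :
    0 ≤ (∑ w : Finset (Fin r), ∑ u ∈ S w, ((if u ∈ A then (1:ℤ) else 0) * ((if u ∈ B then (1:ℤ) else 0) - (if ι u ∈ B then (1:ℤ) else 0))))
        + ∑ ρ : Finset (Fin r), ((if zf ρ ∈ A then (1:ℤ) else 0) * ((if zf ρ ∈ B then (1:ℤ) else 0) - (if ι (zf ρ) ∈ B then (1:ℤ) else 0)))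
        + ∑ ρ : Finset (Fin r), ((if zf' ρ ∈ A then (1:ℤ) else 0) * ((if zf' ρ ∈ B then (1:ℤ) else 0) - (if ι (zf' ρ) ∈ B then (1:ℤ) else 0))) := by
  -- the four port families (up-sets of the cube)
  set a : Finset (Finset (Fin r)) := univ.filter (fun ρ => zf ρ ∈ A) with ha_def
  set a' : Finset (Finset (Fin r)) := univ.filter (fun ρ => zf' ρ ∈ A) with ha'_def
  set b : Finset (Finset (Fin r)) := univ.filter (fun ρ => zf ρ ∈ B) with hb_def
  set b' : Finset (Finset (Fin r)) := univ.filter (fun ρ => zf' ρ ∈ B) with hb'_def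
  have ma : ∀ ρ, ρ ∈ a ↔ zf ρ ∈ A := fun ρ => by simp [ha_def]
  have ma' : ∀ ρ, ρ ∈ a' ↔ zf' ρ ∈ A := fun ρ => by simp [ha'_def]
  have mb : ∀ ρ, ρ ∈ b ↔ zf ρ ∈ B := fun ρ => by simp [hb_def]
  have mb' : ∀ ρ, ρ ∈ b' ↔ zf' ρ ∈ B := fun ρ => by simp [hb'_def]
  have hua : IsUpperSet (a : Set (Finset (Fin r))) := by
    intro ρ ρ' hρ h; rw [Finset.mem_coe, ma] at h ⊢; exact hA _ _ (hzf hρ) h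
  have hua' : IsUpperSet (a' : Set (Finset (Fin r))) := by
    intro ρ ρ' hρ h; rw [Finset.mem_coe, ma'] at h ⊢; exact hA _ _ (hzf' hρ) h
  have hub : IsUpperSet (b : Set (Finset (Fin r))) := by
    intro ρ ρ' hρ h; rw [Finset.mem_coe, mb] at h ⊢; exact hB _ _ (hzf hρ) h
  have hub' : IsUpperSet (b' : Set (Finset (Fin r))) := by
    intro ρ ρ' hρ h; rw [Finset.mem_coe, mb'] at h ⊢; exact hB _ _ (hzf' hρ) h
  -- cardinalities as indicator sums over the cube
  have csum : ∀ (X Y : Finset (Finset (Fin r))), ((X ∩ Y).card : ℤ) = ∑ ρ : Finset (Fin r), (if ρ ∈ X then (1:ℤ) else 0) * (if ρ ∈ Y then (1:ℤ) else 0) := by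
    intro X Y
    have : ∀ ρ : Finset (Fin r), (if ρ ∈ X then (1:ℤ) else 0) * (if ρ ∈ Y then (1:ℤ) else 0) = if ρ ∈ X ∩ Y then (1:ℤ) else 0 := by
      intro ρ; by_cases h1 : ρ ∈ X <;> by_cases h2 : ρ ∈ Y <;> simp [h1, h2, Finset.mem_inter]
    simp_rw [this]; rw [Finset.sum_boole, Finset.filter_mem_eq_inter, Finset.univ_inter]
  -- the zf-port sum = #(a ∩ b) − #(a ∩ b'ᶜˢ)
  have hP1 : ∑ ρ : Finset (Fin r), ((if zf ρ ∈ A then (1:ℤ) else 0) * ((if zf ρ ∈ B then (1:ℤ) else 0) - (if ι (zf ρ) ∈ B then (1:ℤ) else 0)))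
      = ((a ∩ b).card : ℤ) - (a ∩ b'ᶜˢ).card := by
    rw [csum, csum, ← Finset.sum_sub_distrib]
    refine Finset.sum_congr rfl (fun ρ _ => ?_)
    have e1 : (if zf ρ ∈ A then (1:ℤ) else 0) = (if ρ ∈ a then (1:ℤ) else 0) := by simp only [ma]
    have e2 : (if zf ρ ∈ B then (1:ℤ) else 0) = (if ρ ∈ b then (1:ℤ) else 0) := by simp only [mb]
    have e3 : (if ι (zf ρ) ∈ B then (1:ℤ) else 0) = (if ρ ∈ b'ᶜˢ then (1:ℤ) else 0) := by
      rw [hι ρ]; simp only [Finset.mem_compls, mb']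
    rw [e1, e2, e3]; ring
  have hP2 : ∑ ρ : Finset (Fin r), ((if zf' ρ ∈ A then (1:ℤ) else 0) * ((if zf' ρ ∈ B then (1:ℤ) else 0) - (if ι (zf' ρ) ∈ B then (1:ℤ) else 0)))
      = ((a' ∩ b').card : ℤ) - (a' ∩ bᶜˢ).card := by
    rw [csum, csum, ← Finset.sum_sub_distrib]
    refine Finset.sum_congr rfl (fun ρ _ => ?_)
    have e1 : (if zf' ρ ∈ A then (1:ℤ) else 0) = (if ρ ∈ a' then (1:ℤ) else 0) := by simp only [ma']
    have e2 : (if zf' ρ ∈ B then (1:ℤ) else 0) = (if ρ ∈ b' then (1:ℤ) else 0) := by simp only [mb']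
    have e3 : (if ι (zf' ρ) ∈ B then (1:ℤ) else 0) = (if ρ ∈ bᶜˢ then (1:ℤ) else 0) := by
      rw [hι' ρ]; simp only [Finset.mem_compls, mb]
    rw [e1, e2, e3]; ring
  -- the certified worlds pay: Σ_w Σ_{S w} ≥ #(C_V ∪ C_W)
  set C : Finset (Finset (Fin r)) := ((aᶜˢ ∩ b'ᶜˢ) \ (a' ∪ b)) ∪ ((a'ᶜˢ ∩ bᶜˢ) \ (a ∪ b')) with hC_def
  have hworlds : (C.card : ℤ) ≤ ∑ w : Finset (Fin r), ∑ u ∈ S w, ((if u ∈ A then (1:ℤ) else 0) * ((if u ∈ B then (1:ℤ) else 0) - (if ι u ∈ B then (1:ℤ) else 0))) := by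
    have hc : (C.card : ℤ) = ∑ w : Finset (Fin r), (if w ∈ C then (1:ℤ) else 0) := by
      rw [Finset.sum_boole, Finset.filter_mem_eq_inter, Finset.univ_inter]
    rw [hc]
    refine Finset.sum_le_sum (fun w _ => ?_)
    by_cases hw : w ∈ C
    · rw [if_pos hw]
      rw [hC_def, Finset.mem_union] at hw
      rcases hw with hw | hw
      · simp only [Finset.mem_sdiff, Finset.mem_inter, Finset.mem_compls, Finset.mem_union, not_or, ma, ma', mb, mb'] at hw
        exact EV w hw.1.1 hw.2.1 hw.1.2 hw.2.2
      · simp only [Finset.mem_sdiff, Finset.mem_inter, Finset.mem_compls, Finset.mem_union, not_or, ma, ma', mb, mb'] at hw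
        exact EW w hw.1.1 hw.2.1 hw.1.2 hw.2.2
    · rw [if_neg hw]; exact h0 w
  have hcube := port_charge a a' b b' hua hua' hub hub'
  rw [← hC_def] at hcube
  have hcube' : ((a ∩ b'ᶜˢ).card : ℤ) + (a' ∩ bᶜˢ).card ≤ (a ∩ b).card + (a' ∩ b').card + C.card := by exact_mod_cast hcube
  rw [add_assoc, hP1, hP2]
  linarith

end Block

end AntitheticCube

end Summit.CriticalPhenomena.PercolationContinuityZ3.Theorems
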